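import Literature.AlgebraicGeometry.Morphisms.CofanPieceFactorization
import HarnessLib

/-!
# A morphism between coproducts of schemes maps each (pre)connected piece into a unique piece

Topic: `Literature/AlgebraicGeometry/Morphisms`.  PROOF FILE (theorems only; no definition, no named fact).
Let `(f_i : X_i ⟶ S)_{i ∈ σ}` be a COLIMIT cofan in `Scheme` (or in `Over B`), `(f'_j : X'_j ⟶ S')_{j ∈ σ'}` ANY
family of morphisms from non-empty preconnected schemes (e.g. the legs of a second coproduct, pieces irreducible),
and `T : S' ⟶ S` a morphism (a transition or Hecke translate between two levels of a tower of curves, say).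

* `exists_pieceMap_of_isColimit_cofan` — there are an index map `φ : σ' → σ` and lifts `t_j : X'_j ⟶ X_{φ j}` with
  `t_j ≫ f_{φ j} = f'_j ≫ T`: each `f'_j ≫ T` is a morphism from a non-empty preconnected scheme into the coproduct,
  so it factors through some leg (★ `exists_fac_of_preconnectedSpace`); choice assembles `φ` and `t`.
* `pieceMap_index_unique`, `pieceMap_unique` — the index `φ j` and the lift `t_j` are unique
  (★ `cofanFac_index_unique`, ★ `cofanFac_unique`: distinct legs have disjoint images; legs are monomorphisms).
* `Over.exists_pieceMap_of_isColimit_cofan`, `Over.pieceMap_index_unique`, `Over.pieceMap_unique` — the same over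
  a base scheme `B` (e.g. `B = Spec k`, the tree's `SchemeOver k`), via ★ `exists_fac_of_isColimit_cofan_of_mem`,
  ★ `isColimit_cofan_left`, ★ `exists_eq_of_isColimit_cofan`.
* `exists_pieceMap_of_isColimit_cofan_of_irreducibleSpace` (+ `Over.…`) — the form used for geometrically
  irreducible pieces (an irreducible space is non-empty and preconnected, Mathlib instances).
* `Over.exists_stabilizer_action_on_piece` — for `act : Δ →* Aut S`, the stabiliser `Δ_i ≤ Δ` of the piece `X_i`
  (the `δ` whose translate of `X_i` lands in `X_i`) and its action `Δ_i →* Aut X_i` over `act`;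
  `Over.pieceLift_comp_pieceMap_eq` — these automorphisms commute with the piece map over any `Δ`-invariant
  `p : S ⟶ S''` (piecewise form of a Galois cover of a non-connected curve).

This is the «translates permute the pieces» step for towers of (Shimura) curves: the complex fibre of each level
is a coproduct of geometrically irreducible pieces, and any morphism between two levels maps pieces into pieces
(Görtz–Wedhorn I, Lemma 1.19 (1), §(3.5) Example 3.11; Stacks 080G, 04PX).  Ours (corollary layer).

Mathlib searched: `IsPreconnected.subset_isClopen`, `IrreducibleSpace`, `ConnectedSpace`, `Classical.choice`
(used via the ★ pointed factorisations); no statement about morphisms between coproducts of schemes.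

## References
* [GortzWedhorn2020] U. Görtz, T. Wedhorn, *Algebraic Geometry I: Schemes* (2nd ed. 2020), Lemma 1.19 (1) (§(1.5)),
  §(3.5) Proposition 3.10 and Example 3.11 (p. 73).
* [StacksProject] The Stacks Project, Tags 080G, 04PX.
-/

set_option autoImplicit false

noncomputable section

open CategoryTheory CategoryTheory.Limits AlgebraicGeometry Set Function

namespace Literature.AlgebraicGeometry.Morphisms

universe v u

/-! ## §1 In `Scheme` -/

section Scheme

variable {σ : Type v} [Small.{u} σ] {X : σ → Scheme.{u}} {S : Scheme.{u}} {f : ∀ i, X i ⟶ S}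
  {σ' : Type*} {X' : σ' → Scheme.{u}} {S' : Scheme.{u}}

/-- **A morphism into a coproduct of schemes maps each non-empty preconnected piece into some piece.**  For a colimit
cofan `(f_i : X_i ⟶ S)`, any family `f'_j : X'_j ⟶ S'` with `X'_j` non-empty and preconnected, and `T : S' ⟶ S`, there
are `φ : σ' → σ` and `t_j : X'_j ⟶ X_{φ j}` with `t_j ≫ f_{φ j} = f'_j ≫ T` (★ `exists_fac_of_preconnectedSpace` for each
`j`, assembled by choice). [cite: GortzWedhorn2020, Lemma 1.19 (1) (§(1.5)) with §(3.5) Example 3.11 (p. 73)] -/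
theorem exists_pieceMap_of_isColimit_cofan (hc : IsColimit (Cofan.mk S f)) (f' : ∀ j, X' j ⟶ S')
    [∀ j, PreconnectedSpace (X' j)] [∀ j, Nonempty (X' j)] (T : S' ⟶ S) :
    ∃ (φ : σ' → σ) (t : ∀ j, X' j ⟶ X (φ j)), ∀ j, t j ≫ f (φ j) = f' j ≫ T := by
  have h : ∀ j, ∃ (i : σ) (pc : X' j ⟶ X i), pc ≫ f i = f' j ≫ T := fun j =>
    exists_fac_of_preconnectedSpace hc (f' j ≫ T)
  choose φ t ht using h
  exact ⟨φ, t, ht⟩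

/-- **The piece hit is unique**: if `X'_j` (non-empty) maps into `X_i` and into `X_{i'}` compatibly with `f'_j ≫ T`, then
`i = i'` (★ `cofanFac_index_unique`: distinct legs of a colimit cofan of schemes have disjoint images).
[cite: GortzWedhorn2020, §(3.5) Proposition 3.10 and Example 3.11 (p. 73)] -/
theorem pieceMap_index_unique (hc : IsColimit (Cofan.mk S f)) {f' : ∀ j, X' j ⟶ S'} {T : S' ⟶ S} {j : σ'}
    [Nonempty (X' j)] {i i' : σ} (t : X' j ⟶ X i) (t' : X' j ⟶ X i') (h : t ≫ f i = f' j ≫ T)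
    (h' : t' ≫ f i' = f' j ≫ T) : i = i' :=
  cofanFac_index_unique hc t t' h h'

/-- **The lift into the piece is unique** (★ `cofanFac_unique`: the legs of a colimit cofan of schemes are open
immersions, hence monomorphisms). [cite: GortzWedhorn2020, §(3.5) Proposition 3.10 and Example 3.11 (p. 73)] -/
theorem pieceMap_unique (hc : IsColimit (Cofan.mk S f)) {f' : ∀ j, X' j ⟶ S'} {T : S' ⟶ S} {j : σ'} {i : σ}
    (t t' : X' j ⟶ X i) (h : t ≫ f i = f' j ≫ T) (h' : t' ≫ f i = f' j ≫ T) : t = t' :=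
  cofanFac_unique hc t t' (h.trans h'.symm)

/-- **Irreducible pieces map into pieces** — `exists_pieceMap_of_isColimit_cofan` for irreducible `X'_j` (an irreducible
space is non-empty and preconnected). [cite: GortzWedhorn2020, Lemma 1.19 (1) (§(1.5)) with §(3.5) Example 3.11 (p. 73)] -/
theorem exists_pieceMap_of_isColimit_cofan_of_irreducibleSpace (hc : IsColimit (Cofan.mk S f))
    (f' : ∀ j, X' j ⟶ S') [∀ j, IrreducibleSpace (X' j)] (T : S' ⟶ S) :
    ∃ (φ : σ' → σ) (t : ∀ j, X' j ⟶ X (φ j)), ∀ j, t j ≫ f (φ j) = f' j ≫ T :=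
  haveI : ∀ j, Nonempty (X' j) := fun _ => IrreducibleSpace.toNonempty
  exists_pieceMap_of_isColimit_cofan hc f' T

end Scheme

/-! ## §2 In `Over B` -/

section Over

variable {σ : Type v} [Small.{u} σ] {B : Scheme.{u}} {X : σ → Over B} {S : Over B} {f : ∀ i, X i ⟶ S}
  {σ' : Type*} {X' : σ' → Over B} {S' : Over B}

/-- **Over a base: a `B`-morphism into a coproduct maps each non-empty preconnected piece into some piece.**  For a
colimit cofan `(f_i : X_i ⟶ S)` in `Over B`, a family `f'_j : X'_j ⟶ S'` of `B`-morphisms from `B`-schemes with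
non-empty preconnected underlying spaces, and `T : S' ⟶ S`: there are `φ : σ' → σ` and `B`-morphisms
`t_j : X'_j ⟶ X_{φ j}` with `t_j ≫ f_{φ j} = f'_j ≫ T` (the underlying cofan of schemes is a colimit, ★ `isColimit_cofan_left`;
a point of `X'_j` lands in the image of some leg, ★ `exists_eq_of_isColimit_cofan`; ★ `exists_fac_of_isColimit_cofan_of_mem`
lifts over `B`). [cite: GortzWedhorn2020, Lemma 1.19 (1) (§(1.5)) with §(3.5) Example 3.11 (p. 73)] -/
theorem Over.exists_pieceMap_of_isColimit_cofan (hc : IsColimit (Cofan.mk S f)) (f' : ∀ j, X' j ⟶ S')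
    [∀ j, PreconnectedSpace (X' j).left] [∀ j, Nonempty (X' j).left] (T : S' ⟶ S) :
    ∃ (φ : σ' → σ) (t : ∀ j, X' j ⟶ X (φ j)), ∀ j, t j ≫ f (φ j) = f' j ≫ T := by
  obtain ⟨hc'⟩ := isColimit_cofan_left hc
  have h : ∀ j, ∃ (i : σ) (pc : X' j ⟶ X i), pc ≫ f i = f' j ≫ T := fun j => by
    obtain ⟨w⟩ := (inferInstance : Nonempty (X' j).left)
    obtain ⟨i, y, hy⟩ := exists_eq_of_isColimit_cofan hc' ((f' j ≫ T).left w)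
    exact ⟨i, exists_fac_of_isColimit_cofan_of_mem hc (f' j ≫ T) w i ⟨y, hy⟩⟩
  choose φ t ht using h
  exact ⟨φ, t, ht⟩

/-- **Over a base: the piece hit is unique** (underlying schemes: ★ `cofanFac_index_unique` on the underlying colimit
cofan ★ `isColimit_cofan_left`). [cite: GortzWedhorn2020, §(3.5) Proposition 3.10 and Example 3.11 (p. 73)] -/
theorem Over.pieceMap_index_unique (hc : IsColimit (Cofan.mk S f)) {f' : ∀ j, X' j ⟶ S'} {T : S' ⟶ S} {j : σ'}
    [Nonempty (X' j).left] {i i' : σ} (t : X' j ⟶ X i) (t' : X' j ⟶ X i') (h : t ≫ f i = f' j ≫ T)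
    (h' : t' ≫ f i' = f' j ≫ T) : i = i' := by
  obtain ⟨hc'⟩ := isColimit_cofan_left hc
  exact cofanFac_index_unique hc' (p := (f' j ≫ T).left) t.left t'.left
    (by rw [← Over.comp_left, h]) (by rw [← Over.comp_left, h'])

/-- **Over a base: the lift into the piece is unique** (underlying schemes: ★ `cofanFac_unique`; a morphism in `Over B`
is determined by its underlying morphism). [cite: GortzWedhorn2020, §(3.5) Proposition 3.10 and Example 3.11 (p. 73)] -/
theorem Over.pieceMap_unique (hc : IsColimit (Cofan.mk S f)) {f' : ∀ j, X' j ⟶ S'} {T : S' ⟶ S} {j : σ'} {i : σ}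
    (t t' : X' j ⟶ X i) (h : t ≫ f i = f' j ≫ T) (h' : t' ≫ f i = f' j ≫ T) : t = t' := by
  obtain ⟨hc'⟩ := isColimit_cofan_left hc
  refine Over.OverMorphism.ext (cofanFac_unique hc' t.left t'.left ?_)
  rw [← Over.comp_left, ← Over.comp_left, h, h']

/-- **Over a base: irreducible pieces map into pieces** — `Over.exists_pieceMap_of_isColimit_cofan` for `X'_j` with
irreducible underlying spaces (e.g. geometrically irreducible pieces of the complex fibre of a curve).
[cite: GortzWedhorn2020, Lemma 1.19 (1) (§(1.5)) with §(3.5) Example 3.11 (p. 73)] -/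
theorem Over.exists_pieceMap_of_isColimit_cofan_of_irreducibleSpace (hc : IsColimit (Cofan.mk S f))
    (f' : ∀ j, X' j ⟶ S') [∀ j, IrreducibleSpace (X' j).left] (T : S' ⟶ S) :
    ∃ (φ : σ' → σ) (t : ∀ j, X' j ⟶ X (φ j)), ∀ j, t j ≫ f (φ j) = f' j ≫ T :=
  haveI : ∀ j, Nonempty (X' j).left := fun _ => IrreducibleSpace.toNonempty
  Over.exists_pieceMap_of_isColimit_cofan hc f' T

end Over

/-! ## §3 Automorphisms: the stabiliser of a piece acts on the piece -/

section Action

variable {σ : Type v} [Small.{u} σ] {B : Scheme.{u}} {X : σ → Over B} {S : Over B} {f : ∀ i, X i ⟶ S}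
  {Δ : Type*} [Group Δ]

/-- **The stabiliser of a piece acts on the piece.**  For a colimit cofan `(f_i : X_i ⟶ S)` in `Over B` with irreducible
pieces and a group `Δ` acting on `S` by `B`-automorphisms (`act : Δ →* Aut S`), fix a piece `i`.  The `δ ∈ Δ` whose
translate of `X_i` lands in `X_i` — i.e. for which `f_i ≫ act δ` lifts to some `a : X_i ⟶ X_i` — form a subgroup `Δ_i`
(the lift for `δ⁻¹` lands in `X_i` because `f_i = (a ≫ lift) ≫ f_k` forces `k = i`, ★ `cofanFac_index_unique`), and
the lifts assemble to a homomorphism `a_i : Δ_i →* Aut X_i` with `a_i(δ) ≫ f_i = f_i ≫ act δ` (the lifts are unique,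
★ `cofanFac_unique`, hence multiplicative, and `a_i(δ⁻¹)` inverts `a_i(δ)`).  The group that acts faithfully on `X_i`
is the IMAGE `a_i(Δ_i) ≤ Aut X_i` (a `δ` may fix `X_i` pointwise and move other pieces).  Used piece-by-piece on Galois
covers of non-connected curves (Görtz–Wedhorn I, §(3.5) Example 3.11). Ours (corollary layer).
[cite: GortzWedhorn2020, §(3.5) Proposition 3.10 and Example 3.11 (p. 73)] -/
theorem Over.exists_stabilizer_action_on_piece (hc : IsColimit (Cofan.mk S f)) [∀ i, IrreducibleSpace (X i).left]
    (act : Δ →* Aut S) (i : σ) :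
    ∃ (Δi : Subgroup Δ) (ai : Δi →* Aut (X i)),
      (∀ δ : Δi, (ai δ).hom ≫ f i = f i ≫ (act (δ : Δ)).hom) ∧
      (∀ δ : Δ, δ ∈ Δi ↔ ∃ a : X i ⟶ X i, a ≫ f i = f i ≫ (act δ).hom) := by
  classical
  haveI : ∀ j, Nonempty (X j).left := fun _ => IrreducibleSpace.toNonempty
  obtain ⟨hc'⟩ := isColimit_cofan_left hc
  have hmul : ∀ α β : Aut S, (α * β).hom = β.hom ≫ α.hom := fun _ _ => rfl
  have hone : (1 : Aut S).hom = 𝟙 S := rfl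
  have hcancel : ∀ δ₁ δ₂ : Δ, δ₂ * δ₁ = 1 → (act δ₁).hom ≫ (act δ₂).hom = 𝟙 S := by
    intro δ₁ δ₂ h
    rw [← hmul, ← map_mul, h, map_one, hone]
  -- lifts through the leg `f i` are unique
  have huniq : ∀ {a a' : X i ⟶ X i} {g : X i ⟶ S}, a ≫ f i = g → a' ≫ f i = g → a = a' :=
    fun h h' => Over.OverMorphism.ext
      (cofanFac_unique hc' _ _ (by rw [← Over.comp_left, ← Over.comp_left, h, h']))
  -- the stabiliser predicate and its closure properties
  let P : Δ → Prop := fun δ => ∃ a : X i ⟶ X i, a ≫ f i = f i ≫ (act δ).hom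
  have P_one : P 1 := ⟨𝟙 _, by rw [map_one, hone, Category.id_comp, Category.comp_id]⟩
  have P_mul : ∀ {δ₁ δ₂ : Δ}, P δ₁ → P δ₂ → P (δ₁ * δ₂) := by
    rintro δ₁ δ₂ ⟨a₁, h₁⟩ ⟨a₂, h₂⟩
    exact ⟨a₂ ≫ a₁, by rw [map_mul, hmul, Category.assoc, h₁, reassoc_of% h₂]⟩
  have P_inv : ∀ {δ : Δ}, P δ → P δ⁻¹ := by
    rintro δ ⟨a, h⟩
    -- factor `f i ≫ act δ⁻¹` through some piece `k`
    obtain ⟨w⟩ := (inferInstance : Nonempty (X i).left)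
    obtain ⟨k, y, hy⟩ := exists_eq_of_isColimit_cofan hc' ((f i ≫ (act δ⁻¹).hom).left w)
    obtain ⟨b, hb⟩ := exists_fac_of_isColimit_cofan_of_mem hc (f i ≫ (act δ⁻¹).hom) w k ⟨y, hy⟩
    -- `f i` factors through the legs `k` (via `a ≫ b`) and `i` (via `𝟙`), so `k = i`
    have hab : (a ≫ b) ≫ f k = f i := by
      rw [Category.assoc, hb, reassoc_of% h, hcancel δ δ⁻¹ (inv_mul_cancel δ), Category.comp_id]
    have hki : k = i :=
      cofanFac_index_unique hc' (p := (f i).left) (a ≫ b).left (𝟙 _)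
        (by rw [← Over.comp_left, hab]) (by rw [Category.id_comp])
    subst hki
    exact ⟨b, hb⟩
  let Δi : Subgroup Δ :=
    { carrier := {δ | P δ}
      one_mem' := P_one
      mul_mem' := fun h₁ h₂ => P_mul h₁ h₂
      inv_mem' := fun h => P_inv h }
  have hP : ∀ δ : Δi, P (δ : Δ) := fun δ => δ.2
  choose a ha using hP
  have hinv₁ : ∀ δ : Δi, a δ⁻¹ ≫ a δ = 𝟙 _ := fun δ =>
    huniq (g := f i)
      (by rw [Category.assoc, ha δ, reassoc_of% (ha δ⁻¹), Subgroup.coe_inv,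
        hcancel _ _ (mul_inv_cancel (δ : Δ)), Category.comp_id])
      (Category.id_comp _)
  have hinv₂ : ∀ δ : Δi, a δ ≫ a δ⁻¹ = 𝟙 _ := fun δ =>
    huniq (g := f i)
      (by rw [Category.assoc, ha δ⁻¹, reassoc_of% (ha δ), Subgroup.coe_inv,
        hcancel _ _ (inv_mul_cancel (δ : Δ)), Category.comp_id])
      (Category.id_comp _)
  let e : Δi → Aut (X i) := fun δ => ⟨a δ, a δ⁻¹, hinv₂ δ, hinv₁ δ⟩
  have e_hom : ∀ δ, (e δ).hom = a δ := fun _ => rfl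
  refine ⟨Δi, { toFun := e, map_one' := ?_, map_mul' := ?_ }, fun δ => ha δ, fun δ => Iff.rfl⟩
  · -- `a 1 = 𝟙`
    refine Iso.ext ?_
    rw [e_hom]
    change a 1 = 𝟙 _
    exact huniq (ha 1) (by rw [OneMemClass.coe_one, map_one, hone, Category.id_comp, Category.comp_id])
  · -- `a (δ₁ δ₂) = a δ₂ ≫ a δ₁`
    intro δ₁ δ₂
    refine Iso.ext ?_
    rw [e_hom]
    change a (δ₁ * δ₂) = a δ₂ ≫ a δ₁
    exact huniq (ha _)
      (by rw [Subgroup.coe_mul, map_mul, hmul, Category.assoc, ha δ₁, reassoc_of% (ha δ₂)])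

omit [Small.{u} σ] in
/-- **Piece automorphisms commute with the piece map over an invariant morphism.**  If `Δ` acts on `S` over
`p : S ⟶ S''` (`act δ ≫ p = p`), `(g_k : Y_k ⟶ S'')` is a colimit cofan, `t : X_i ⟶ Y_k` lifts `f_i ≫ p`
(★ `Over.exists_pieceMap_of_isColimit_cofan`) and `a : X_i ⟶ X_i` lifts `f_i ≫ act δ`, then `a ≫ t = t`: both are
lifts of `f_i ≫ p` through the leg `g_k` (★ `cofanFac_unique`).  So the stabiliser `Δ_i` of
`Over.exists_stabilizer_action_on_piece` acts on `X_i` OVER the piece `Y_k` it maps to — the piecewise form of a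
Galois cover of non-connected curves. [cite: GortzWedhorn2020, §(3.5) Proposition 3.10 and Example 3.11 (p. 73)] -/
theorem Over.pieceLift_comp_pieceMap_eq {σ'' : Type*} [Small.{u} σ''] {Y : σ'' → Over B} {S'' : Over B} {g : ∀ k, Y k ⟶ S''}
    (hcY : IsColimit (Cofan.mk S'' g)) (p : S ⟶ S'') {δS : S ⟶ S} (hp : δS ≫ p = p) {i : σ} {k : σ''}
    (t : X i ⟶ Y k) (ht : t ≫ g k = f i ≫ p) {a : X i ⟶ X i} (ha : a ≫ f i = f i ≫ δS) : a ≫ t = t :=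
  Over.pieceMap_unique hcY (f' := fun _ : Unit => f i) (T := p) (j := ()) _ _
    (by rw [Category.assoc, ht, reassoc_of% ha, hp]) ht

end Action

end Literature.AlgebraicGeometry.Morphisms

end
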